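import Summits.BirchSwinnertonDyer.Rank1Residual.X2.DualRestrictionSelmer
import Summits.BirchSwinnertonDyer.Rank1Residual.X2.GreenbergSelmerCountSplit
import Summits.BirchSwinnertonDyer.Rank1Residual.Additive.ClassicalConditionAwayBadPlaces
import HarnessLib

/-!
# The trivial-zero quotient `S^{Σ₀}_A(K_∞)/S^{Σ₀,str}_A(K_∞)` at a split multiplicative prime:
# the classical groups are the strict ones (no reduction hypotheses away from `p`), monotonicity
# in `Σ₀`, finite `p`-torsion, and `ℤ_p`-corank `1` when infinite

HONEST FRAMING (BSD rank-`≤ 1` residual cell `b2b-bsdres`, home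
`run/shared/lean/b2b/bsd-rank1-residual/`, unit `b2b-bsdres-eisenstein-p2`, class X2; research route,
no claim beyond stated classes): the cell deletes the COMBINATION-SHAPED residual classes of the
rank-`≤ 1` BSD formula from PUBLISHED theorems only and TYPES the construction-shaped ones; this is
not "finishing BSD". THEOREMS ONLY (no definition, no named fact, nothing asserted).

GV pp. 14–15: at a SPLIT multiplicative prime "`Sel_E(ℚ_∞)_p` coincides with the 'strict' Selmer
group … But `S_{E[p^∞]}(ℚ_∞)` is actually bigger". In the kernel:

* §1 `nonPrimitiveSelmerInfty_eq_gvStrictSelmerInfty_of_strictKer_eq` — `Sel^{Σ₀}_E(K_∞)_p =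
  S^{Σ₀,str}_A(K_∞)` for ANY data with `strictKer = localKerOver` above `p` and EVERY finite
  `Σ₀ ∌ p` (bad places outside `Σ₀` allowed: the `v ∤ p` LINK of team n1011,
  `Additive.localKerOver_le_unramKer` / `unramKer_le_localKerOver_of_isCyclotomic`);
* §2 `infinite_quotient_mono` — `S_A/S^{str}_A ↪ S^{Σ₀}_A/S^{Σ₀,str}_A`;
* §3 `finite_torsionBy_quotient_and_zpCorank_le`, `zpCorank_quotient_eq_one_of_infinite` — the
  quotient embeds in `D ≅ ℚ_p/ℤ_p` (`TrivialZeroQuotient.exists_trivialZeroHom`): finite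
  `p`-torsion of order `∣ p`, corank `≤ 1`, and `= 1` as soon as the quotient is infinite.

References: GV 2000 = arXiv:math/9906215 pp. 14–17, 20; Greenberg LNM 1716 §2 pp. 69–76, p. 93.
-/

noncomputable section

open scoped Classical AddSubgroup

universe u v

namespace Summit.BirchSwinnertonDyer.Rank1Residual.X2.TrivialZeroQuotientCorank

open NumberField IsDedekindDomain Field WeierstrassCurve
  Literature.NumberTheory.EllipticCurves Literature.NumberTheory.EllipticCurves.GreenbergSelmer
  Literature.NumberTheory.EllipticCurves.GreenbergVatsal2000
  Literature.NumberTheory.EllipticCurves.IwasawaDual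
  Literature.NumberTheory.GaloisRepresentations
  Summit.BirchSwinnertonDyer.Rank1Residual.X2.GreenbergVatsalTorsion
  Summit.BirchSwinnertonDyer.Rank1Residual.X2.GreenbergVatsalStrictSelmer
  Summit.BirchSwinnertonDyer.Rank1Residual.X2.GreenbergVatsalSelmerEquality
  Summit.BirchSwinnertonDyer.Rank1Residual.X2.TrivialZeroQuotient
  Summit.BirchSwinnertonDyer.Rank1Residual.X2.TrivialZeroCorankAlgebra
  Summit.BirchSwinnertonDyer.Rank1Residual.X2.DualRestrictionSelmer

/-! ## §1. `Sel^{Σ₀}_E(K_∞)_p = S^{Σ₀,str}_A(K_∞)` without reduction hypotheses away from `p` -/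

section StrictEquality

variable {K : Type} [Field K] [NumberField K] (W : WeierstrassCurve K) [W.IsElliptic] (p : ℕ)
  [hp : Fact p.Prime] (κ : ZpExtension K p) (S₀ : Set (HeightOneSpectrum (𝓞 K)))

/-- **`Sel^{Σ₀}_E(K_∞)_p = S^{Σ₀,str}_{E[p^∞]}(K_∞)` — bad places outside `Σ₀` allowed.** `p` odd,
`κ` cyclotomic, `L` data above `p` with the STRICT condition equal to the Kummer condition at every
`v ∣ p` (the Tate data at a multiplicative prime, Greenberg p. 76), `Σ₀ ∌ v ∣ p`: at `v ∉ Σ₀`,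
`v ∤ p` the LINK (any reduction), at `v ∣ p` the hypothesis, at `∞` both conditions are empty for
odd `p`. X2's `nonPrimitiveSelmerInfty_eq_gvStrictSelmerInfty_of_le` minus its `hS`.
[cite: GreenbergVatsal2000, §1 pp. 7–8, §2 pp. 14–17] [cite: GreenbergLNM1716, §2 pp. 69–76] -/
theorem nonPrimitiveSelmerInfty_eq_gvStrictSelmerInfty_of_strictKer_eq (hp2 : p ≠ 2)
    (hκ : κ.IsCyclotomic) (L : Data K (W.geomPrimaryTorsion p) p)
    (hRD : ∀ (v : HeightOneSpectrum (𝓞 K)) (hv : ((p : ℕ) : 𝓞 K) ∈ v.asIdeal),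
      (L v hv).strictKer κ.kerSubgroup = W.localKerOver p κ.kerSubgroup (v.adicCompletion K))
    (hS₀ : ∀ v ∈ S₀, ((p : ℕ) : 𝓞 K) ∉ v.asIdeal) :
    nonPrimitiveSelmerInfty W κ S₀ = gvStrictSelmerInfty κ (W.geomPrimaryTorsion p) L S₀ := by
  apply le_antisymm
  · intro c hc
    have hc' : c ∈ nonPrimitiveSelmerGroupOver W p κ.kerSubgroup S₀ := hc
    rw [mem_nonPrimitiveSelmerGroupOver_iff] at hc'
    change c ∈ gvStrictSelmer κ.kerSubgroup (W.geomPrimaryTorsion p) p L S₀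
    rw [mem_gvStrictSelmer_iff]
    refine ⟨fun v hv hpv σ ↦ Additive.localKerOver_le_unramKer (κ := κ) (v := v) (W := W) (p := p)
      hpv (hc'.1 v hv σ), fun v hv σ ↦ ?_⟩
    rw [hRD v hv]
    exact hc'.1 v (fun hvS ↦ hS₀ v hvS hv) σ
  · intro c hgv
    change c ∈ nonPrimitiveSelmerGroupOver W p κ.kerSubgroup S₀
    rw [mem_nonPrimitiveSelmerGroupOver_iff]
    have hgv' := (mem_gvStrictSelmer_iff (H := κ.kerSubgroup) (M := W.geomPrimaryTorsion p)
      (p := p) (L := L) (S₀ := S₀) c).1 hgv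
    refine ⟨fun v hvS σ ↦ ?_, fun w σ ↦ ?_⟩
    · by_cases hpv : ((p : ℕ) : 𝓞 K) ∈ v.asIdeal
      · rw [← hRD v hpv]
        exact hgv'.2 v hpv σ
      · exact Additive.unramKer_le_localKerOver_of_isCyclotomic (κ := κ) (v := v) (W := W) (p := p)
          hκ hpv (hgv'.1 v hvS hpv σ)
    · rw [localKerOver_completion_eq_top_of_odd W p hp2]
      exact AddSubgroup.mem_top _

/-- **`Sel_E(K_∞)_p = S^{str}_{E[p^∞]}(K_∞)` (`Σ₀ = ∅`)** under the same hypotheses.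
[cite: GreenbergVatsal2000, §2 pp. 14–17] -/
theorem selmerInfty_eq_gvStrictSelmerInfty_of_strictKer_eq (hp2 : p ≠ 2) (hκ : κ.IsCyclotomic)
    (L : Data K (W.geomPrimaryTorsion p) p)
    (hRD : ∀ (v : HeightOneSpectrum (𝓞 K)) (hv : ((p : ℕ) : 𝓞 K) ∈ v.asIdeal),
      (L v hv).strictKer κ.kerSubgroup = W.localKerOver p κ.kerSubgroup (v.adicCompletion K)) :
    W.selmerInfty κ = gvStrictSelmerInfty κ (W.geomPrimaryTorsion p) L ∅ := by
  rw [← nonPrimitiveSelmerInfty_eq_gvStrictSelmerInfty_of_strictKer_eq W p κ ∅ hp2 hκ L hRD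
    (fun _ h ↦ h.elim)]
  change W.selmerGroupOver p κ.kerSubgroup = nonPrimitiveSelmerGroupOver W p κ.kerSubgroup ∅
  rw [nonPrimitiveSelmerGroupOver_empty]

end StrictEquality

/-! ## §2. `S_A/S^{str}_A ↪ S^{Σ₀}_A/S^{Σ₀,str}_A` -/

section Mono

variable {K : Type u} [Field K] [NumberField K] {p : ℕ} [hp : Fact p.Prime] (κ : ZpExtension K p)
  (M : Type u) [AddCommGroup M] [DistribMulAction (absoluteGaloisGroup K) M] [TopologicalSpace M]
  [DiscreteTopology M] (L : Data K M p) (S₀ : Set (HeightOneSpectrum (𝓞 K)))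

/-- **The trivial-zero quotient only grows with `Σ₀`**: `S_A(K_∞)/S^{str}_A(K_∞)` injects into
`S^{Σ₀}_A(K_∞)/S^{Σ₀,str}_A(K_∞)` (a class of `S_A` strict for `Σ₀` is strict: the two groups differ
only in the condition above `p`), so the latter is infinite when the former is.
[cite: GreenbergVatsal2000, §2 pp. 15–16, 20] -/
theorem infinite_quotient_mono
    [hinf : Infinite (↥(gvSelmerInfty κ M L ∅) ⧸
      (gvStrictSelmerInfty κ M L ∅).addSubgroupOf (gvSelmerInfty κ M L ∅))] :
    Infinite (↥(gvSelmerInfty κ M L S₀) ⧸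
      (gvStrictSelmerInfty κ M L S₀).addSubgroupOf (gvSelmerInfty κ M L S₀)) := by
  have hle : gvSelmerInfty κ M L ∅ ≤ gvSelmerInfty κ M L S₀ := by
    intro c hc
    have hc' := (mem_gvSelmer_iff (H := κ.kerSubgroup) (M := M) (p := p) (L := L) (S₀ := ∅) c).1 hc
    exact (mem_gvSelmer_iff (H := κ.kerSubgroup) (M := M) (p := p) (L := L) (S₀ := S₀) c).2
      ⟨fun v _ hpv σ ↦ hc'.1 v (Set.notMem_empty v) hpv σ, hc'.2⟩
  -- a class of `S_A` that is `Σ₀`-strict is `∅`-strict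
  have hkey : ∀ c : ↥(gvSelmerInfty κ M L ∅),
      ((c : subgroupH1 κ.kerSubgroup M) ∈ gvStrictSelmerInfty κ M L S₀) →
        (c : subgroupH1 κ.kerSubgroup M) ∈ gvStrictSelmerInfty κ M L ∅ := by
    intro c hc
    have hc' := (mem_gvStrictSelmer_iff (H := κ.kerSubgroup) (M := M) (p := p) (L := L)
      (S₀ := S₀) (c : subgroupH1 κ.kerSubgroup M)).1 hc
    have hc0 := (mem_gvSelmer_iff (H := κ.kerSubgroup) (M := M) (p := p) (L := L) (S₀ := ∅)
      (c : subgroupH1 κ.kerSubgroup M)).1 c.2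
    exact (mem_gvStrictSelmer_iff (H := κ.kerSubgroup) (M := M) (p := p) (L := L) (S₀ := ∅)
      (c : subgroupH1 κ.kerSubgroup M)).2 ⟨hc0.1, hc'.2⟩
  have hNM : (gvStrictSelmerInfty κ M L ∅).addSubgroupOf (gvSelmerInfty κ M L ∅) ≤
      ((gvStrictSelmerInfty κ M L S₀).addSubgroupOf (gvSelmerInfty κ M L S₀)).comap
        (AddSubgroup.inclusion hle) := by
    intro c hc
    rw [AddSubgroup.mem_comap, AddSubgroup.mem_addSubgroupOf, AddSubgroup.coe_inclusion]
    rw [AddSubgroup.mem_addSubgroupOf] at hc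
    have hc' := (mem_gvStrictSelmer_iff (H := κ.kerSubgroup) (M := M) (p := p) (L := L)
      (S₀ := ∅) (c : subgroupH1 κ.kerSubgroup M)).1 hc
    exact (mem_gvStrictSelmer_iff (H := κ.kerSubgroup) (M := M) (p := p) (L := L) (S₀ := S₀)
      (c : subgroupH1 κ.kerSubgroup M)).2 ⟨fun v _ hpv σ ↦ hc'.1 v (Set.notMem_empty v) hpv σ, hc'.2⟩
  let f := QuotientAddGroup.map ((gvStrictSelmerInfty κ M L ∅).addSubgroupOf (gvSelmerInfty κ M L ∅))
    ((gvStrictSelmerInfty κ M L S₀).addSubgroupOf (gvSelmerInfty κ M L S₀))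
    (AddSubgroup.inclusion hle) hNM
  refine Infinite.of_injective f fun x y hxy ↦ ?_
  induction x using QuotientAddGroup.induction_on with
  | H a =>
    induction y using QuotientAddGroup.induction_on with
    | H b =>
      have hxy' : (QuotientAddGroup.mk (AddSubgroup.inclusion hle a) : ↥(gvSelmerInfty κ M L S₀) ⧸
          (gvStrictSelmerInfty κ M L S₀).addSubgroupOf (gvSelmerInfty κ M L S₀)) =
          QuotientAddGroup.mk (AddSubgroup.inclusion hle b) := by
        have ha := QuotientAddGroup.map_mk ((gvStrictSelmerInfty κ M L ∅).addSubgroupOf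
          (gvSelmerInfty κ M L ∅)) ((gvStrictSelmerInfty κ M L S₀).addSubgroupOf
          (gvSelmerInfty κ M L S₀)) (AddSubgroup.inclusion hle) hNM a
        have hb := QuotientAddGroup.map_mk ((gvStrictSelmerInfty κ M L ∅).addSubgroupOf
          (gvSelmerInfty κ M L ∅)) ((gvStrictSelmerInfty κ M L S₀).addSubgroupOf
          (gvSelmerInfty κ M L S₀)) (AddSubgroup.inclusion hle) hNM b
        rw [← ha, ← hb]
        exact hxy
      rw [QuotientAddGroup.eq_iff_sub_mem, AddSubgroup.mem_addSubgroupOf, ← map_sub,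
        AddSubgroup.coe_inclusion] at hxy'
      rw [QuotientAddGroup.eq_iff_sub_mem, AddSubgroup.mem_addSubgroupOf]
      exact hkey (a - b) hxy'

end Mono

/-! ## §3. The trivial-zero quotient: finite `p`-torsion, corank `1` when infinite -/

section Quotient

variable (W : WeierstrassCurve ℚ) [W.IsElliptic] (p : ℕ) [hp : Fact p.Prime] (κ : ZpExtension ℚ p)
  (L : Data ℚ (W.geomPrimaryTorsion p) p) (S₀ : Set (HeightOneSpectrum (𝓞 ℚ)))

/-- **`(S^{Σ₀}_A/S^{Σ₀,str}_A)[p]` is finite of order dividing `p`, and the quotient has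
`ℤ_p`-corank `≤ 1`** — it embeds in `D ≅ ℚ_p/ℤ_p` by the trivial-zero map
(`exists_trivialZeroHom`; `#D[p] = p` for a divisible line `C` with `#C[p] = p`).
[cite: GreenbergVatsal2000, §2 pp. 14–16, 20] -/
theorem finite_torsionBy_quotient_and_zpCorank_le (hκ : κ.IsCyclotomic)
    (hC : ∀ (v : HeightOneSpectrum (𝓞 ℚ)) (hv : ((p : ℕ) : 𝓞 ℚ) ∈ v.asIdeal),
      (∀ c ∈ (L v hv).plus, ∃ c' ∈ (L v hv).plus, p • c' = c) ∧
        Nat.card ↥((L v hv).plus ⊓ (↥(W.geomPrimaryTorsion p))[(p : ℤ)]) = p)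
    (htrivD : ∀ (v : HeightOneSpectrum (𝓞 ℚ)) (hv : ((p : ℕ) : 𝓞 ℚ) ∈ v.asIdeal),
      ∀ (δ : decomp (K := ℚ) v) (d : (L v hv).Gr), δ • d = d) :
    Finite ((↥(gvSelmerInfty κ (W.geomPrimaryTorsion p) L S₀) ⧸
      (gvStrictSelmerInfty κ (W.geomPrimaryTorsion p) L S₀).addSubgroupOf
        (gvSelmerInfty κ (W.geomPrimaryTorsion p) L S₀))[(p : ℤ)]) ∧
      zpCorank (↥(gvSelmerInfty κ (W.geomPrimaryTorsion p) L S₀) ⧸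
        (gvStrictSelmerInfty κ (W.geomPrimaryTorsion p) L S₀).addSubgroupOf
          (gvSelmerInfty κ (W.geomPrimaryTorsion p) L S₀)) p ≤ 1 := by
  -- the place above `p` and the trivial-zero map `Φ : S → D`
  set v₀ : HeightOneSpectrum (𝓞 ℚ) := (Rat.HeightOneSpectrum.primesEquiv (R := 𝓞 ℚ)).symm ⟨p, hp.out⟩
    with hv₀def
  have hv₀ : ((p : ℕ) : 𝓞 ℚ) ∈ v₀.asIdeal :=
    (natCast_mem_asIdeal_iff_eq_primesEquiv_symm v₀ hp.out).mpr hv₀def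
  obtain ⟨Φ, hΦ⟩ := exists_trivialZeroHom W p κ L htrivD S₀ hκ hv₀
  -- `N = ker Φ`, so `S/N ≅ range Φ ≤ D`
  have hN : ((gvStrictSelmerInfty κ (W.geomPrimaryTorsion p) L S₀).addSubgroupOf (gvSelmerInfty κ (W.geomPrimaryTorsion p) L S₀)) = Φ.ker := by
    ext c
    rw [AddSubgroup.mem_addSubgroupOf, AddMonoidHom.mem_ker, hΦ]
  let e : ↥(gvSelmerInfty κ (W.geomPrimaryTorsion p) L S₀) ⧸
      ((gvStrictSelmerInfty κ (W.geomPrimaryTorsion p) L S₀).addSubgroupOf (gvSelmerInfty κ (W.geomPrimaryTorsion p) L S₀)) ≃+ Φ.range :=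
    (QuotientAddGroup.quotientAddEquivOfEq hN).trans (QuotientAddGroup.quotientKerEquivRange Φ)
  obtain ⟨hfinGr, hcardGr⟩ :=
    finite_and_natCard_torsionBy_gr W p (L v₀ hv₀) (hC v₀ hv₀).1 (hC v₀ hv₀).2
  haveI := hfinGr
  obtain ⟨hfinR, hdvd⟩ := finite_and_natCard_torsionBy_dvd_of_le (p : ℤ) Φ.range
  haveI := hfinR
  rw [hcardGr] at hdvd
  haveI hfinQ : Finite ((↥(gvSelmerInfty κ (W.geomPrimaryTorsion p) L S₀) ⧸
      ((gvStrictSelmerInfty κ (W.geomPrimaryTorsion p) L S₀).addSubgroupOf (gvSelmerInfty κ (W.geomPrimaryTorsion p) L S₀)))[(p : ℤ)]) :=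
    Finite.of_equiv _ (torsionByEquiv e p).symm.toEquiv
  refine ⟨hfinQ, ?_⟩
  rw [zpCorank_congr e p]
  -- `#R[p] ∣ p` ⇒ `dim R[p] ≤ 1` ⇒ corank `≤ 1`
  letI : Module (ZMod p) (↥Φ.range)[(p : ℤ)] := AddSubgroup.torsionBy.zmodModule
  haveI : Module.Finite (ZMod p) (↥Φ.range)[(p : ℤ)] := Module.Finite.of_finite
  have hdim : Module.finrank (ZMod p) (↥Φ.range)[(p : ℤ)] ≤ 1 := by
    have hcard := Module.natCard_eq_pow_finrank (K := ZMod p) (V := (↥Φ.range)[(p : ℤ)])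
    rw [Nat.card_zmod] at hcard
    have hle : p ^ Module.finrank (ZMod p) (↥Φ.range)[(p : ℤ)] ≤ p ^ 1 := by
      rw [← hcard, pow_one]
      exact Nat.le_of_dvd hp.out.pos hdvd
    exact (Nat.pow_le_pow_iff_right hp.out.one_lt).mp hle
  unfold zpCorank
  exact le_trans (Nat.sub_le _ _) hdim

/-- **The trivial-zero quotient has `ℤ_p`-corank exactly `1` when it is infinite** (`≤ 1` by the
embedding in `D`; `≠ 0` because a `p`-primary group with finite `p`-torsion and corank `0` is
finite, `finite_of_zpCorank_eq_zero`). [cite: GreenbergVatsal2000, §2 pp. 14–16, 20] -/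
theorem zpCorank_quotient_eq_one_of_infinite (hκ : κ.IsCyclotomic)
    (hC : ∀ (v : HeightOneSpectrum (𝓞 ℚ)) (hv : ((p : ℕ) : 𝓞 ℚ) ∈ v.asIdeal),
      (∀ c ∈ (L v hv).plus, ∃ c' ∈ (L v hv).plus, p • c' = c) ∧
        Nat.card ↥((L v hv).plus ⊓ (↥(W.geomPrimaryTorsion p))[(p : ℤ)]) = p)
    (htrivD : ∀ (v : HeightOneSpectrum (𝓞 ℚ)) (hv : ((p : ℕ) : 𝓞 ℚ) ∈ v.asIdeal),
      ∀ (δ : decomp (K := ℚ) v) (d : (L v hv).Gr), δ • d = d)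
    [hinf : Infinite (↥(gvSelmerInfty κ (W.geomPrimaryTorsion p) L S₀) ⧸
      (gvStrictSelmerInfty κ (W.geomPrimaryTorsion p) L S₀).addSubgroupOf
        (gvSelmerInfty κ (W.geomPrimaryTorsion p) L S₀))] :
    zpCorank (↥(gvSelmerInfty κ (W.geomPrimaryTorsion p) L S₀) ⧸
      (gvStrictSelmerInfty κ (W.geomPrimaryTorsion p) L S₀).addSubgroupOf
        (gvSelmerInfty κ (W.geomPrimaryTorsion p) L S₀)) p = 1 := by
  obtain ⟨hfin, hle⟩ := finite_torsionBy_quotient_and_zpCorank_le W p κ L S₀ hκ hC htrivD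
  haveI := hfin
  have hprim := DualRestrictionSelmer.isPrimary_quotient W κ L S₀
    (T := gvStrictSelmerInfty κ (W.geomPrimaryTorsion p) L S₀)
  have hne : zpCorank (↥(gvSelmerInfty κ (W.geomPrimaryTorsion p) L S₀) ⧸
      (gvStrictSelmerInfty κ (W.geomPrimaryTorsion p) L S₀).addSubgroupOf
        (gvSelmerInfty κ (W.geomPrimaryTorsion p) L S₀)) p ≠ 0 := fun h0 ↦
    hinf.not_finite (finite_of_zpCorank_eq_zero p hprim h0)
  omega

end Quotient

end Summit.BirchSwinnertonDyer.Rank1Residual.X2.TrivialZeroQuotientCorank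

end
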